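import Mathlib
import Literature.NumberTheory.LFunctions.Zhang2022.Section17Eq171Edges
import Literature.NumberTheory.LFunctions.Zhang2022.Section8Step8u016
import Literature.NumberTheory.LFunctions.Zhang2022.Section4ContourTools
import HarnessLib

/-!
# Zhang (2022) §17 (17.2), first half: "we move the segment `𝔍(α)` to `𝔍(1)`" for `I₄⁺(ψ)`,
# `ψ ∈ Ψ₁` — an edge from Proposition 2.2 (i)

Topic `Literature/NumberTheory/LFunctions/Zhang2022` (Landau–Siegel audit tree; verdict-neutral).
Y. Zhang, *Discrete mean estimates and the Landau–Siegel zero*, arXiv:2211.02515v1 (2022)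
[Zhang2022LandauSiegel] — **an unrefereed manuscript under adjudication**; nothing here asserts or
denies its Theorems 1–2. DAG node `Z22:(17.2)` [Z22 p.95, (17.2), tex L4711–L4716]:

> "To treat the sum of `I₄⁺(ψ)` we move the segment `𝔍(α)` to `𝔍(1)`, and then extend the sum over
> `Ψ₁` to the sum over `Ψ` with an acceptable error. Hence
> `Σ_{ψ∈Ψ₁}(p_ψt₀)^{β₃}I₄⁺(ψ) = Σ_{p∼P}(pt₀)^{β₃}Φ₃⁺(p) + o(𝔓)`."  (17.2)

This file proves the FIRST of the two moves, with the error `O(ε)`, `ε = e^{−𝓛¹⁰/16}`: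
`eq17_2a_of_prop22i : Skeleton.Prop22i → ∀ c′, ∃ c > 0, ∃ C, ForAllLarge ((A) →
‖Σ_{ψ∈Ψ₁}(p_ψt₀)^{β₃}I₄⁺(ψ) − Σ_{ψ∈Ψ₁}(p_ψt₀)^{β₃}(1/2πi)∫_{𝔍(1)}𝔨₃(s,ψ)ω(s)ds‖ ≤ C·e^{−c𝓛¹⁰})`.
It is the §17 twin of the tree's `Z22:§8.u016` ("moving the segment `𝔍(α)` to `𝔍(1)` gives
`Σ_{ψ∈Ψ₁} I₁⁺ = Θ₁ + O(ε)`", `Step8u016.step8u016_of`, files `Section8Step8u016(Tools)`), whose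
scaffolding is reused verbatim: per `ψ ∈ Ψ₁`, Cauchy's theorem on the rectangle
`[½+α, 3/2] × [2πt₀−𝓛₁, 2πt₀+𝓛₁]` (`Section7aStatements.norm_intJ_sub_intJ_le`), on which the
integrand `𝔨₃(s,ψ)ω(s) = L(s+β₁,ψ)B(s,ψ)G(s,ψ)N(s+β₂,ψ)N(s+β₃,ψ)F(1−s,ψ̄)ω(s)/L(s,ψ)` is holomorphic
because "by Proposition 2.2" (i) the zeros of `L(s,ψ)L(s,ψχ)` in `Ω` lie on `σ = ½`
(`Step8u016.LFunction_ne_zero_of_onLine`); on the two horizontal sides the integrand is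
`≤ K·P¹²·e^{3C𝓛⁹(1+9log𝓛)}·e^{−𝓛¹⁰/4}` by the trivial bounds `|B| ≤ K_ι(P+1)²`, `|G| ≤ D⁸`,
`|N(s+β_j,ψ)| ≤ P+1` (`Typed.Section17.norm_Bpoly_le_trivial` etc., file `Section17Eq171Edges`),
`|F(1−s,ψ̄)| ≤ D⁵⁶` (`Section4.norm_FpolyBar_le_pow`), `|L(s+β₁,ψ)| ≤ p(|t|+5)Z`
(`Step8u016.norm_LFunction_shift_le`), the lower bound `|L(s,ψ)| ≥ e^{−C(1+log(1/α))(log p+log(|t|+4))}`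
off the zeros (`DirichletDisc.exp_neg_le_norm_LFunction`, all disc zeros on the line), and the
Gaussian `ω`; summing over `#Ψ₁ ≤ 𝔓 ≤ 4P²` characters with `|(p_ψt₀)^{β₃}| = 1` and absorbing
`P¹⁴e^{O(𝓛⁹log𝓛)}` into `e^{3𝓛¹⁰/16}` (`Step8u016.growth_le`) gives `e^{−𝓛¹⁰/16}`.

Theorems only; no definitions, no named facts; axioms standard. ZHANG-L discharge lane (WP16,
seat zl-w16-p6), first helper toward the leaf `Typed.Section17.Eq17_6Rel` of
`Skeleton.theorem1_of_leaves_v19` (chain: (17.2) = this move + the `Ψ₁ → Ψ` extension; (17.3) is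
the tree's `Phi3Eval.eq17_3_holds`; §17.u007; (17.5), (17.6) by the tree's edges `eq17_5_of`,
`eq17_6_of`, `eq17_6Rel_of_eq17_6`). WHAT THIS IS NOT: a claim about Proposition 2.2, about the
second half of (17.2), about Theorems 1–2 of the source, or about Landau–Siegel zeros.

## References

* Y. Zhang, arXiv:2211.02515v1 (2022), §17 (17.2) p.95 (tex L4711–L4716); §8 p.43 (tex
  L2255–L2258, the same move for `I₁⁺`); §2 (2.13), (2.15). [cite: Zhang2022LandauSiegel, §17 (17.2) p.95]
* H. L. Montgomery, R. C. Vaughan, *Multiplicative Number Theory I* (2007), Lemma 10.15 / §11.1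
  (the disc bounds behind `DirichletDisc`). [cite: MontgomeryVaughan2007, Lemma 10.15]
-/

noncomputable section

open Complex Real Set Metric MeasureTheory
open Literature.NumberTheory.LFunctions.Zhang2022.Skeleton
open Literature.NumberTheory.LFunctions.Zhang2022.Typed.Section17
open Literature.NumberTheory.LFunctions.Zhang2022.Section8aStatements (beta_eq_b_mul_I)

namespace Literature.NumberTheory.LFunctions.Zhang2022.Eq172

/-! ## Holomorphy of `𝔨₃(s,ψ)ω(s)` on the rectangle `[½+α, 3/2] × [2πt₀−𝓛₁, 2πt₀+𝓛₁]` -/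

section Holomorphy

variable (c' : ℝ) {D : ℕ} [NeZero D] {χ : DirichletCharacter ℂ D} (x : Chr D)

omit [NeZero D] in
/-- `𝔨₃(s,ψ)ω(s) = G(s)/L(s,ψ)` with the entire numerator
`G(s) = L(s+β₁,ψ)B(s,ψ)G(s,ψ)N(s+β₂,ψ)N(s+β₃,ψ)F(1−s,ψ̄)ω(s)` of
`Typed.Section17.differentiable_numerator3`. [cite: Zhang2022LandauSiegel, §17 u001 p.95] -/
theorem kfrak3_mul_omega_eq_div (s : ℂ) :
    kfrak3 c' χ x s * omegaW D s =
      (x.ψ.LFunction (s + beta1 c' D) * Bpoly χ x s * Gpoly χ x s *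
        Nchar D (psiFn x) (s + beta2 c' D) * Nchar D (psiFn x) (s + beta3 c' D) *
        FpolyBar χ x (1 - s) * omegaW D s) / x.ψ.LFunction s := by
  simp only [kfrak3, div_eq_mul_inv]
  ring

/-- **The integrand of `I₄⁺`/`Φ₃⁺` is holomorphic on the closed rectangle
`[½+α, 3/2] × [2πt₀−𝓛₁, 2πt₀+𝓛₁]`** for `ψ ∈ Ψ₁` (zeros of `L(s,ψ)L(s,ψχ)` in `Ω` on the line,
`0 < α ≤ 1`): the numerator is entire and `L(s,ψ) ≠ 0` there.
[cite: Zhang2022LandauSiegel, §17 (17.2) p.95] -/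
theorem differentiableOn_kfrak3_omega (h22 : ∀ s ∈ prodZeroSetOmega χ x, s.re = 1 / 2)
    (hα0 : 0 < alpha D) (hα1 : alpha D ≤ 1) :
    DifferentiableOn ℂ (fun s => kfrak3 c' χ x s * omegaW D s)
      (Set.uIcc (1 / 2 + alpha D) (1 / 2 + 1) ×ℂ
        Set.uIcc (2 * π * t0 D - ell1 D) (2 * π * t0 D + ell1 D)) := by
  intro s hs
  have hre : 1 / 2 + alpha D ≤ s.re ∧ s.re ≤ 1 / 2 + 1 := by
    have h := hs.1
    rw [Set.uIcc_of_le (by linarith)] at h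
    exact h
  have hℓ1 : 0 ≤ ell1 D := pow_nonneg (Real.log_natCast_nonneg D) _
  have him : 2 * π * t0 D - ell1 D ≤ s.im ∧ s.im ≤ 2 * π * t0 D + ell1 D := by
    have h := hs.2
    rw [Set.uIcc_of_le (by linarith)] at h
    exact h
  have himw : |s.im - 2 * π * t0 D| < ell1 D + 2 := by
    rw [abs_lt]; constructor <;> linarith
  have hL : x.ψ.LFunction s ≠ 0 := Step8u016.LFunction_ne_zero_of_onLine h22 (by linarith) himw
  have hfun : (fun s => kfrak3 c' χ x s * omegaW D s) = fun s =>
      (x.ψ.LFunction (s + beta1 c' D) * Bpoly χ x s * Gpoly χ x s *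
        Nchar D (psiFn x) (s + beta2 c' D) * Nchar D (psiFn x) (s + beta3 c' D) *
        FpolyBar χ x (1 - s) * omegaW D s) / x.ψ.LFunction s := by
    funext s; exact kfrak3_mul_omega_eq_div c' x s
  rw [hfun]
  refine DifferentiableAt.differentiableWithinAt ?_
  exact ((differentiable_numerator3 χ x c').differentiableAt).div
    ((DirichletCharacter.differentiable_LFunction x.ψ_ne_one).differentiableAt) hL

end Holomorphy

/-! ## The size of `𝔨₃(s,ψ)ω(s)` on the horizontal sides -/

section EdgeBound

variable (c' : ℝ) {D : ℕ} [NeZero D] {χ : DirichletCharacter ℂ D} (x : Chr D)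

omit [NeZero D] in
/-- The shifts `β₂, β₃` are purely imaginary: `Re(s + β_j) = Re s`.
[cite: Zhang2022LandauSiegel, §2 (2.13)] -/
theorem re_add_beta23 (s : ℂ) :
    (s + beta2 c' D).re = s.re ∧ (s + beta3 c' D).re = s.re := by
  obtain ⟨-, e2, e3⟩ := beta_eq_b_mul_I c' D
  constructor
  · rw [e2]; simp
  · rw [e3]; simp

/-- **The integrand on the horizontal sides.** Let `ψ ∈ Ψ₁` with the zeros of `L(s,ψ)L(s,ψχ)` in `Ω`
on the line, `D ≥ 3`, `𝓛 ≥ 3`, `0 < α ≤ 1/6`, `|c′|α𝓛 ≤ 1`, and `s = u + it` with `½+α ≤ u ≤ 3/2`,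
`|t − 2πt₀| ≤ 𝓛₁`, `t ≥ 1`. Then
`|𝔨₃(s,ψ)ω(s)| ≤ [p(|t|+5)Z]·exp(C(1+log(1/α))(log p + log(|t|+4)))·[K_ι(P+1)²]·D⁸·(P+1)²·D⁵⁶
 ·(√π/𝓛₂)·exp(((u−½)² − (t−2πt₀)²)/(4𝓛₂²))`, `K_ι = (1+|ι₂|)(|ι₃|+|ι₄|)`, `C` the absolute
constant of `DirichletDisc.exp_neg_le_norm_LFunction`.
[cite: Zhang2022LandauSiegel, §17 (17.2) p.95] -/
theorem norm_kfrak3_omega_le {C : ℝ}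
    (hC : ∀ (q : ℕ) [NeZero q] (θ : DirichletCharacter ℂ q), θ ≠ 1 → ∀ t σ d : ℝ,
      1 / 2 ≤ σ → σ ≤ 2 → 0 < d → d ≤ 1 →
        (∀ ρ ∈ DirichletDisc.discZeros θ t, ∀ y ∈ Icc σ 2, d ≤ ‖(y : ℂ) + t * I - ρ‖) →
          Real.exp (-(C * (1 + Real.log (1 / d)) * (Real.log q + Real.log (|t| + 4)))) ≤
            ‖θ.LFunction ((σ : ℂ) + t * I)‖)
    (h22 : ∀ s ∈ prodZeroSetOmega χ x, s.re = 1 / 2) (hD : 3 ≤ D) (hℓ : 3 ≤ ell D)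
    (hα0 : 0 < alpha D) (hα : alpha D ≤ 1 / 6) (hc : |c'| * (alpha D * ell D) ≤ 1)
    {u t : ℝ} (hu1 : 1 / 2 + alpha D ≤ u) (hu2 : u ≤ 3 / 2) (ht : |t - 2 * π * t0 D| ≤ ell1 D)
    (ht1 : 1 ≤ t) :
    ‖kfrak3 c' χ x ((u : ℂ) + t * I) * omegaW D ((u : ℂ) + t * I)‖ ≤
      ((x.p : ℝ) * (|t| + 5) * DirichletDisc.Zc) *
        Real.exp (C * (1 + Real.log (1 / alpha D)) * (Real.log x.p + Real.log (|t| + 4))) *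
        ((1 + ‖iota2‖) * (‖iota3‖ + ‖iota4‖) * (bigP D + 1) ^ 2) * (D : ℝ) ^ 8 *
        (bigP D + 1) ^ 2 * (D : ℝ) ^ 56 *
        (Real.sqrt π / ell2 D * Real.exp (((u - 1 / 2) ^ 2 - (t - 2 * π * t0 D) ^ 2) /
          (4 * ell2 D ^ 2))) := by
  set s : ℂ := (u : ℂ) + t * I with hs
  have hsre : s.re = u := by simp [hs]
  have hsim : s.im = t := by simp [hs]
  have hp0 : (0 : ℝ) < x.p := by exact_mod_cast x.prime.pos
  have hD1 : 1 ≤ D := le_trans (by norm_num) hD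
  have hlog2 : 2 ≤ Real.log D := le_trans (by norm_num) hℓ
  have hZc : 1 ≤ DirichletDisc.Zc := DirichletDisc.one_le_Zc
  obtain ⟨hb1, -, -⟩ := Step8u016.abs_b_le_one c' hα0.le hα hc
  obtain ⟨e1, -, -⟩ := beta_eq_b_mul_I c' D
  -- the factors
  have hreI : s.re ∈ Icc (1 / 2 : ℝ) 2 := by rw [hsre]; constructor <;> linarith
  have hL1 : ‖x.ψ.LFunction (s + beta1 c' D)‖ ≤ x.p * (|t| + 5) * DirichletDisc.Zc := by
    rw [e1, ← hsim]; exact Step8u016.norm_LFunction_shift_le x hreI hb1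
  -- the lower bound for `L(s,ψ)`: all disc zeros are on the line, at distance `≥ α` from `[u, 2] + it`
  have hα1 : alpha D ≤ 1 := by linarith
  have hdist := DirichletDisc.dist_segment_of_re_le (χ := x.ψ) (t := t) (σ := u) (d := alpha D)
    (fun ρ hρ => by rw [Step8u016.discZeros_re_eq_half h22 ht ρ hρ]; linarith)
  have hLlow := hC x.p x.ψ x.ψ_ne_one t u (alpha D) (by linarith) (by linarith) hα0 hα1 hdist
  set E : ℝ := Real.exp (C * (1 + Real.log (1 / alpha D)) * (Real.log x.p + Real.log (|t| + 4)))
    with hE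
  have hE0 : 0 < E := Real.exp_pos _
  have hLs0 : 0 < ‖x.ψ.LFunction s‖ := lt_of_lt_of_le (Real.exp_pos _) hLlow
  have hF4 : ‖(x.ψ.LFunction s)⁻¹‖ ≤ E := by
    rw [norm_inv, inv_le_comm₀ hLs0 hE0, hE, ← Real.exp_neg]
    exact hLlow
  -- the Dirichlet polynomials
  have hsre0 : 0 ≤ s.re := by rw [hsre]; linarith
  have hB : ‖Bpoly χ x s‖ ≤ (1 + ‖iota2‖) * (‖iota3‖ + ‖iota4‖) * (bigP D + 1) ^ 2 :=
    norm_Bpoly_le_trivial χ x hlog2 hsre0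
  have hG : ‖Gpoly χ x s‖ ≤ (D : ℝ) ^ 8 := norm_Gpoly_le_trivial χ x hsre0
  obtain ⟨hre2, hre3⟩ := re_add_beta23 c' (D := D) s
  have hN2 : ‖Nchar D (psiFn x) (s + beta2 c' D)‖ ≤ bigP D + 1 :=
    norm_Nchar_le_trivial x hℓ (by rw [hre2]; exact hsre0)
  have hN3 : ‖Nchar D (psiFn x) (s + beta3 c' D)‖ ≤ bigP D + 1 :=
    norm_Nchar_le_trivial x hℓ (by rw [hre3]; exact hsre0)
  have hF : ‖FpolyBar χ x (1 - s)‖ ≤ (D : ℝ) ^ 56 :=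
    Section4.norm_FpolyBar_le_pow χ x hD1 (by simp [hsre]; linarith)
  -- the weight
  have hℓ2 : 0 < ell2 D := pow_pos (by linarith) _
  have hω : ‖omegaW D s‖ = Real.sqrt π / ell2 D *
      Real.exp (((u - 1 / 2) ^ 2 - (t - 2 * π * t0 D) ^ 2) / (4 * ell2 D ^ 2)) := by
    have hs' : s = ((u - 1 / 2 : ℝ) : ℂ) + SmoothWeight.s0 (t0 D) + ((t - 2 * π * t0 D : ℝ) : ℂ) * I := by
      rw [hs, SmoothWeight.s0_def]; push_cast; ring
    rw [omegaW, hs', SmoothWeight.norm_omega_segment_eq hℓ2]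
  -- assembly
  have hfun : kfrak3 c' χ x s * omegaW D s =
      x.ψ.LFunction (s + beta1 c' D) * (x.ψ.LFunction s)⁻¹ * Bpoly χ x s * Gpoly χ x s *
        Nchar D (psiFn x) (s + beta2 c' D) * Nchar D (psiFn x) (s + beta3 c' D) *
        FpolyBar χ x (1 - s) * omegaW D s := by
    rw [kfrak3, div_eq_mul_inv]
  rw [hfun, norm_mul, norm_mul, norm_mul, norm_mul, norm_mul, norm_mul, norm_mul, hω]
  have hPZ : 0 ≤ (x.p : ℝ) * (|t| + 5) * DirichletDisc.Zc :=
    mul_nonneg (mul_nonneg hp0.le (by positivity)) (le_trans zero_le_one hZc)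
  have hP1 : 0 ≤ bigP D + 1 := by have := Real.exp_pos (ell D ^ 9); rw [bigP]; linarith
  have hKι : 0 ≤ (1 + ‖iota2‖) * (‖iota3‖ + ‖iota4‖) * (bigP D + 1) ^ 2 := by positivity
  have hω0 : 0 ≤ Real.sqrt π / ell2 D *
      Real.exp (((u - 1 / 2) ^ 2 - (t - 2 * π * t0 D) ^ 2) / (4 * ell2 D ^ 2)) :=
    mul_nonneg (div_nonneg (Real.sqrt_nonneg _) hℓ2.le) (Real.exp_pos _).le
  have g1 : ‖x.ψ.LFunction (s + beta1 c' D)‖ * ‖(x.ψ.LFunction s)⁻¹‖ ≤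
      ((x.p : ℝ) * (|t| + 5) * DirichletDisc.Zc) * E :=
    mul_le_mul hL1 hF4 (norm_nonneg _) hPZ
  have g2 := mul_le_mul g1 hB (norm_nonneg _) (mul_nonneg hPZ hE0.le)
  have g3 := mul_le_mul g2 hG (norm_nonneg _) (mul_nonneg (mul_nonneg hPZ hE0.le) hKι)
  have g4 := mul_le_mul g3 hN2 (norm_nonneg _)
    (mul_nonneg (mul_nonneg (mul_nonneg hPZ hE0.le) hKι) (by positivity))
  have g5 := mul_le_mul g4 hN3 (norm_nonneg _)
    (mul_nonneg (mul_nonneg (mul_nonneg (mul_nonneg hPZ hE0.le) hKι) (by positivity)) hP1)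
  have g6 := mul_le_mul g5 hF (norm_nonneg _)
    (mul_nonneg (mul_nonneg (mul_nonneg (mul_nonneg (mul_nonneg hPZ hE0.le) hKι)
      (by positivity)) hP1) hP1)
  have g7 := mul_le_mul_of_nonneg_right g6 hω0
  refine g7.trans (le_of_eq ?_)
  ring

end EdgeBound

/-! ## The uniform bound on the horizontal sides and the move `𝔍(α) → 𝔍(1)` -/

section Assembly

variable (c' : ℝ) {D : ℕ} [NeZero D] {χ : DirichletCharacter ℂ D}

omit [NeZero D] in
/-- `D ≤ P^{1/8}`-type bookkeeping: `D⁶⁴ ≤ P⁶` for `𝓛 ≥ 3` (`D = e^{𝓛}`, `P = e^{𝓛⁹}`, `64𝓛 ≤ 6𝓛⁹`).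
[cite: Zhang2022LandauSiegel, §2 (2.1), (2.6)] -/
theorem natCast_pow_64_le_bigP_pow (hD : 3 ≤ D) (hℓ : 3 ≤ ell D) : (D : ℝ) ^ 64 ≤ bigP D ^ 6 := by
  have hD0 : (0 : ℝ) < D := by exact_mod_cast lt_of_lt_of_le (by norm_num) hD
  have hDexp : (D : ℝ) = Real.exp (ell D) := by rw [ell, Real.exp_log hD0]
  rw [hDexp, bigP, ← Real.exp_nat_mul, ← Real.exp_nat_mul, Real.exp_le_exp]
  push_cast
  have hℓ1 : 1 ≤ ell D := by linarith
  have h8 : (3 : ℝ) ^ 8 ≤ ell D ^ 8 := pow_le_pow_left₀ (by norm_num) hℓ 8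
  have h9 : ell D ^ 9 = ell D ^ 8 * ell D := by ring
  rw [h9]
  nlinarith

set_option maxHeartbeats 400000 in
/-- **The integrand on either horizontal side, uniformly in `ψ` and `u`**: with the hypotheses of
`norm_kfrak3_omega_le` and `𝓛 ≥ 3`, `π|c′| ≤ 𝓛⁸`, on `s = u + i(2πt₀ ± 𝓛₁)`, `½+α ≤ u ≤ 3/2`,
`|𝔨₃ω| ≤ K·P¹²·exp(3C𝓛⁹(1 + 9log𝓛))·e^{−𝓛¹⁰/4}`, `K = 39Z·K_ι·16·6`.
[cite: Zhang2022LandauSiegel, §17 (17.2) p.95] -/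
theorem norm_kfrak3_omega_le_uniform {C : ℝ} (hC0 : 0 < C)
    (hC : ∀ (q : ℕ) [NeZero q] (θ : DirichletCharacter ℂ q), θ ≠ 1 → ∀ t σ d : ℝ,
      1 / 2 ≤ σ → σ ≤ 2 → 0 < d → d ≤ 1 →
        (∀ ρ ∈ DirichletDisc.discZeros θ t, ∀ y ∈ Icc σ 2, d ≤ ‖(y : ℂ) + t * I - ρ‖) →
          Real.exp (-(C * (1 + Real.log (1 / d)) * (Real.log q + Real.log (|t| + 4)))) ≤
            ‖θ.LFunction ((σ : ℂ) + t * I)‖)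
    (x : Chr D) (h22 : ∀ s ∈ prodZeroSetOmega χ x, s.re = 1 / 2) (hD : 3 ≤ D) (hℓ : 3 ≤ ell D)
    (hc : π * |c'| ≤ ell D ^ 8)
    {u : ℝ} (hu1 : 1 / 2 + alpha D ≤ u) (hu2 : u ≤ 1 / 2 + 1) {t : ℝ}
    (ht : t = 2 * π * t0 D + ell1 D ∨ t = 2 * π * t0 D - ell1 D) :
    ‖kfrak3 c' χ x ((u : ℂ) + t * I) * omegaW D ((u : ℂ) + t * I)‖ ≤
      (39 * DirichletDisc.Zc * ((1 + ‖iota2‖) * (‖iota3‖ + ‖iota4‖)) * 16 * 6) * bigP D ^ 12 *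
        Real.exp (3 * C * ell D ^ 9 * (1 + 9 * Real.log (ell D))) *
        Real.exp (-(ell D ^ 10) / 4) := by
  obtain ⟨hα0, hα6, hα1⟩ := Step8u016.alpha_small hℓ
  obtain ⟨hwin, hℓ1t0, ht01, hℓ21, hℓ10⟩ := Step8u016.window_sizes hℓ
  have hcα := Step8u016.abs_c_mul_alpha_ell_le_one hℓ hc
  have hπ3 := Real.pi_gt_three
  have hπ4 := Real.pi_lt_four
  have hπt : π * t0 D ≤ 7 / 2 * t0 D :=
    mul_le_mul_of_nonneg_right (by linarith [Real.pi_lt_d2]) (by linarith)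
  have hπt' : 3 * t0 D ≤ π * t0 D := mul_le_mul_of_nonneg_right hπ3.le (by linarith)
  have htabs : |t - 2 * π * t0 D| ≤ ell1 D := by
    rcases ht with ht' | ht'
    · rw [ht', show 2 * π * t0 D + ell1 D - 2 * π * t0 D = ell1 D by ring, abs_of_nonneg hℓ10]
    · rw [ht', show 2 * π * t0 D - ell1 D - 2 * π * t0 D = -ell1 D by ring, abs_neg,
        abs_of_nonneg hℓ10]
  have ht1 : 1 ≤ t := by rcases ht with ht' | ht' <;> rw [ht'] <;> linarith
  have htle : |t| ≤ 8 * t0 D := by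
    rw [abs_of_pos (by linarith)]
    rcases ht with ht' | ht' <;> rw [ht'] <;> linarith
  -- sizes
  have hP0 : 0 < bigP D := Real.exp_pos _
  have hP1 : 1 ≤ bigP D := Real.one_le_exp (pow_nonneg (Real.log_natCast_nonneg D) 9)
  have hp3 := Step8u016.chr_p_le_three_bigP hℓ x
  have hp1 : (1 : ℝ) ≤ x.p := by exact_mod_cast x.prime.one_lt.le
  have ht0P := Step8u016.t0_le_bigP hℓ
  have hZ1 : 1 ≤ DirichletDisc.Zc := DirichletDisc.one_le_Zc
  have ht4 : |t| + 4 ≤ 12 * bigP D := by nlinarith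
  set Kι : ℝ := (1 + ‖iota2‖) * (‖iota3‖ + ‖iota4‖) with hKι
  have hKι0 : 0 ≤ Kι := by rw [hKι]; positivity
  -- factor 1: `p(|t|+5)Z ≤ 3P·13P·Z`
  have f1 : (x.p : ℝ) * (|t| + 5) * DirichletDisc.Zc ≤ 3 * bigP D * (13 * bigP D) * DirichletDisc.Zc := by
    apply mul_le_mul_of_nonneg_right _ (by linarith)
    exact mul_le_mul hp3 (by nlinarith) (by positivity) (by linarith)
  -- factor 2: the exponent
  have f2 : Real.exp (C * (1 + Real.log (1 / alpha D)) * (Real.log x.p + Real.log (|t| + 4))) ≤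
      Real.exp (3 * C * ell D ^ 9 * (1 + 9 * Real.log (ell D))) := by
    rw [Real.exp_le_exp, mul_assoc]
    have h := Step8u016.log_factor_le hℓ hp1 hp3 ht4
    calc C * ((1 + Real.log (1 / alpha D)) * (Real.log x.p + Real.log (|t| + 4)))
        ≤ C * ((1 + 9 * Real.log (ell D)) * (3 * ell D ^ 9)) := mul_le_mul_of_nonneg_left h hC0.le
      _ = 3 * C * ell D ^ 9 * (1 + 9 * Real.log (ell D)) := by ring
  -- factor 3: `Kι(P+1)² ≤ Kι·4P²`
  have f3 : Kι * (bigP D + 1) ^ 2 ≤ Kι * (4 * bigP D ^ 2) := by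
    apply mul_le_mul_of_nonneg_left _ hKι0
    nlinarith
  -- factor 4 and 6: `D⁸·D⁵⁶ = D⁶⁴ ≤ P⁶`
  have f46 : (D : ℝ) ^ 8 * (D : ℝ) ^ 56 ≤ bigP D ^ 6 := by
    rw [← pow_add]; exact natCast_pow_64_le_bigP_pow hD hℓ
  -- factor 5: `(P+1)² ≤ 4P²`
  have f5 : (bigP D + 1) ^ 2 ≤ 4 * bigP D ^ 2 := by nlinarith
  -- factor 7: the Gaussian
  have f7 : Real.sqrt π / ell2 D * Real.exp (((u - 1 / 2) ^ 2 - (t - 2 * π * t0 D) ^ 2) /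
      (4 * ell2 D ^ 2)) ≤ 6 * Real.exp (-(ell D ^ 10) / 4) := by
    have hsq : (t - 2 * π * t0 D) ^ 2 = ell1 D ^ 2 := by
      rcases ht with ht' | ht' <;> rw [ht'] <;> ring
    rw [hsq]
    exact Step8u016.omega_edge_le hℓ (pow_le_one₀ (by linarith) (by linarith))
  -- combine
  have hbase := norm_kfrak3_omega_le c' x hC h22 hD hℓ hα0 hα6 hcα hu1 (by linarith) htabs ht1
  refine hbase.trans ?_
  have hD0 : (0 : ℝ) ≤ (D : ℝ) := Nat.cast_nonneg _
  have h0f1 : 0 ≤ (x.p : ℝ) * (|t| + 5) * DirichletDisc.Zc := by positivity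
  have h0f2 : 0 ≤ Real.exp (C * (1 + Real.log (1 / alpha D)) * (Real.log x.p + Real.log (|t| + 4))) :=
    (Real.exp_pos _).le
  have h0f3 : 0 ≤ Kι * (bigP D + 1) ^ 2 := by positivity
  have h0ω : 0 ≤ Real.sqrt π / ell2 D * Real.exp (((u - 1 / 2) ^ 2 - (t - 2 * π * t0 D) ^ 2) /
      (4 * ell2 D ^ 2)) :=
    mul_nonneg (div_nonneg (Real.sqrt_nonneg _) (by linarith)) (Real.exp_pos _).le
  -- regroup the left side as (f1)(f2)(f3)(D⁸ D⁵⁶)((P+1)²)(gauss)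
  have hregroup : (x.p : ℝ) * (|t| + 5) * DirichletDisc.Zc *
        Real.exp (C * (1 + Real.log (1 / alpha D)) * (Real.log x.p + Real.log (|t| + 4))) *
        ((1 + ‖iota2‖) * (‖iota3‖ + ‖iota4‖) * (bigP D + 1) ^ 2) * (D : ℝ) ^ 8 *
        (bigP D + 1) ^ 2 * (D : ℝ) ^ 56 *
        (Real.sqrt π / ell2 D * Real.exp (((u - 1 / 2) ^ 2 - (t - 2 * π * t0 D) ^ 2) /
          (4 * ell2 D ^ 2))) =
      ((x.p : ℝ) * (|t| + 5) * DirichletDisc.Zc) *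
        Real.exp (C * (1 + Real.log (1 / alpha D)) * (Real.log x.p + Real.log (|t| + 4))) *
        (Kι * (bigP D + 1) ^ 2) * ((D : ℝ) ^ 8 * (D : ℝ) ^ 56) * (bigP D + 1) ^ 2 *
        (Real.sqrt π / ell2 D * Real.exp (((u - 1 / 2) ^ 2 - (t - 2 * π * t0 D) ^ 2) /
          (4 * ell2 D ^ 2))) := by rw [hKι]; ring
  rw [hregroup]
  calc ((x.p : ℝ) * (|t| + 5) * DirichletDisc.Zc) *
        Real.exp (C * (1 + Real.log (1 / alpha D)) * (Real.log x.p + Real.log (|t| + 4))) *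
        (Kι * (bigP D + 1) ^ 2) * ((D : ℝ) ^ 8 * (D : ℝ) ^ 56) * (bigP D + 1) ^ 2 *
        (Real.sqrt π / ell2 D * Real.exp (((u - 1 / 2) ^ 2 - (t - 2 * π * t0 D) ^ 2) /
          (4 * ell2 D ^ 2)))
      ≤ (3 * bigP D * (13 * bigP D) * DirichletDisc.Zc) *
        Real.exp (3 * C * ell D ^ 9 * (1 + 9 * Real.log (ell D))) *
        (Kι * (4 * bigP D ^ 2)) * bigP D ^ 6 * (4 * bigP D ^ 2) *
        (6 * Real.exp (-(ell D ^ 10) / 4)) := by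
        have e1 := mul_le_mul f1 f2 h0f2 (by positivity)
        have e2 := mul_le_mul e1 f3 h0f3 (by positivity)
        have e3 := mul_le_mul e2 f46 (by positivity) (by positivity)
        have e4 := mul_le_mul e3 f5 (by positivity) (by positivity)
        exact mul_le_mul e4 f7 h0ω (by positivity)
    _ = (39 * DirichletDisc.Zc * Kι * 16 * 6) * bigP D ^ 12 *
        Real.exp (3 * C * ell D ^ 9 * (1 + 9 * Real.log (ell D))) *
        Real.exp (-(ell D ^ 10) / 4) := by ring

/-- **`Z22:(17.2)`, first half, as an edge from Proposition 2.2 (i)**: if for `ψ ∈ Ψ₁` the zeros of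
`L(s,ψ)L(s,ψχ)` in `Ω` lie on the critical line (`Skeleton.Prop22i`), then for every `c′`
"moving the segment `𝔍(α)` to `𝔍(1)`" costs `O(ε)` uniformly:
`‖Σ_{ψ∈Ψ₁}(p_ψt₀)^{β₃}I₄⁺(ψ) − Σ_{ψ∈Ψ₁}(p_ψt₀)^{β₃}(1/2πi)∫_{𝔍(1)}𝔨₃(s,ψ)ω(s)ds‖ ≤ 1·e^{−𝓛¹⁰/16}`
for all large `D` (Assumption (A) is not used). Per `ψ`: Cauchy's theorem on
`[½+α, 3/2]×[2πt₀−𝓛₁, 2πt₀+𝓛₁]` (`Section7aStatements.norm_intJ_sub_intJ_le` with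
`differentiableOn_kfrak3_omega`) leaves the two horizontal sides, each
`≤ K P¹²e^{3C𝓛⁹(1+9log𝓛)}e^{−𝓛¹⁰/4}` pointwise (`norm_kfrak3_omega_le_uniform`); `|(p_ψt₀)^{β₃}| = 1`;
summing over `#Ψ₁ ≤ 𝔓 ≤ 4P²` and absorbing `P¹⁴e^{O(𝓛⁹log𝓛)}` into `e^{3𝓛¹⁰/16}`
(`Step8u016.growth_le`). [cite: Zhang2022LandauSiegel, §17 (17.2) p.95, tex L4711–L4716] -/
theorem eq17_2a_of_prop22i (h22 : Prop22i) (c' : ℝ) :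
    ∃ c : ℝ, 0 < c ∧ ∃ C : ℝ, ForAllLarge fun D _ χ => AssumptionA D χ →
      ‖(∑ x ∈ finsetOf (PsiOne χ),
            (((x.p : ℝ) * t0 D : ℝ) : ℂ) ^ beta3 c' D * I4 c' χ x (alpha D)) -
          ∑ x ∈ finsetOf (PsiOne χ), (((x.p : ℝ) * t0 D : ℝ) : ℂ) ^ beta3 c' D *
            Lemma81.segInt (t0 D) (ell1 D) 1 (fun s => kfrak3 c' χ x s * omegaW D s)‖ ≤
        C * Real.exp (-c * ell D ^ 10) := by
  classical
  obtain ⟨C, hC0, hC⟩ := DirichletDisc.exp_neg_le_norm_LFunction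
  obtain ⟨D₁, h22'⟩ := h22
  obtain ⟨D₂, hfrakP⟩ := Step8u016.frakP_le_eventually
  -- the growth threshold on `𝓛`
  set K : ℝ := 39 * DirichletDisc.Zc * ((1 + ‖iota2‖) * (‖iota3‖ + ‖iota4‖)) * 16 * 6 with hK
  have hK0 : 0 ≤ K := by rw [hK]; have := DirichletDisc.one_le_Zc; positivity
  obtain ⟨D₃, hD₃f⟩ := Skeleton.exists_forall_le_ell
    (max 3 (max (π * |c'| + 1) (max (64 * (4 * K) + 1) ((8 * (14 + 57 * C)) ^ 2))))
  refine ⟨1 / 16, by norm_num, 1, max (max D₁ D₂) (max D₃ 3), fun D _ χ hD hq hp _ => ?_⟩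
  have hD₁ : D₁ ≤ D := le_trans (le_trans (le_max_left _ _) (le_max_left _ _)) hD
  have hD₂ : D₂ ≤ D := le_trans (le_trans (le_max_right _ _) (le_max_left _ _)) hD
  have hD₃ : D₃ ≤ D := le_trans (le_trans (le_max_left _ _) (le_max_right _ _)) hD
  have hD3 : 3 ≤ D := le_trans (le_trans (le_max_right _ _) (le_max_right _ _)) hD
  have hM := hD₃f D hD₃
  have hℓ3 : 3 ≤ ell D := le_trans (le_max_left _ _) hM
  have hℓc : π * |c'| + 1 ≤ ell D := le_trans (le_trans (le_max_left _ _) (le_max_right _ _)) hM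
  have hℓK : 64 * (4 * K) + 1 ≤ ell D :=
    le_trans (le_trans (le_trans (le_max_left _ _) (le_max_right _ _)) (le_max_right _ _)) hM
  have hℓA : (8 * (14 + 57 * C)) ^ 2 ≤ ell D :=
    le_trans (le_trans (le_trans (le_max_right _ _) (le_max_right _ _)) (le_max_right _ _)) hM
  have hℓ1 : 1 ≤ ell D := by linarith
  have hℓ0 : 0 < ell D := by linarith
  have h22D := h22' D χ hD₁ hq hp
  obtain ⟨hα0, hα6, hα1⟩ := Step8u016.alpha_small hℓ3
  obtain ⟨-, -, ht01, -, -⟩ := Step8u016.window_sizes hℓ3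
  have ht0pos : 0 < t0 D := by linarith
  have hc8 : π * |c'| ≤ ell D ^ 8 := by
    have : ell D ≤ ell D ^ 8 := by
      calc ell D = ell D ^ 1 := (pow_one _).symm
        _ ≤ ell D ^ 8 := pow_le_pow_right₀ hℓ1 (by norm_num)
    linarith
  -- the uniform side bound `Mval`
  set Mval : ℝ := K * bigP D ^ 12 * Real.exp (3 * C * ell D ^ 9 * (1 + 9 * Real.log (ell D))) *
    Real.exp (-(ell D ^ 10) / 4) with hMval
  have hMval0 : 0 ≤ Mval := by rw [hMval]; positivity
  -- per character: `‖(pt₀)^{β₃}(I₄⁺ − (1/2πi)∫_{𝔍(1)})‖ ≤ Mval`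
  have hper : ∀ x ∈ finsetOf (PsiOne χ),
      ‖(((x.p : ℝ) * t0 D : ℝ) : ℂ) ^ beta3 c' D * I4 c' χ x (alpha D) -
          (((x.p : ℝ) * t0 D : ℝ) : ℂ) ^ beta3 c' D *
            Lemma81.segInt (t0 D) (ell1 D) 1 (fun s => kfrak3 c' χ x s * omegaW D s)‖ ≤ Mval := by
    intro x hx
    have hx' : x ∈ PsiOne χ := mem_of_mem_finsetOf hx
    have h22x : ∀ s ∈ prodZeroSetOmega χ x, s.re = 1 / 2 := h22D x hx'
    set F : ℂ → ℂ := fun s => kfrak3 c' χ x s * omegaW D s with hF_def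
    have hF := differentiableOn_kfrak3_omega c' x h22x hα0 hα1
    have hside : ∀ t : ℝ, (t = 2 * π * t0 D + ell1 D ∨ t = 2 * π * t0 D - ell1 D) →
        ∀ u ∈ Set.Icc (1 / 2 + alpha D) (1 / 2 + 1), ‖F ((u : ℂ) + ((t : ℝ) : ℂ) * I)‖ ≤ Mval := by
      intro t ht u hu
      have h := norm_kfrak3_omega_le_uniform c' hC0 hC x h22x hD3 hℓ3 hc8 hu.1 hu.2 ht
      rw [hMval, hK]; exact h
    have hmove := Section7aStatements.norm_intJ_sub_intJ_le D (z₁ := alpha D) (z₂ := 1)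
      (M₁ := Mval) (M₂ := Mval) hα1 hF (hside _ (Or.inl rfl)) (hside _ (Or.inr rfl))
    -- `I₄⁺ − segInt 1 = (intJ α − intJ 1)/(2πi)`
    have hI : I4 c' χ x (alpha D) - Lemma81.segInt (t0 D) (ell1 D) 1 F =
        (Section7aStatements.intJ D (alpha D) F - Section7aStatements.intJ D 1 F) / (2 * π * I) := by
      rw [show I4 c' χ x (alpha D) = Lemma81.segInt (t0 D) (ell1 D) ((alpha D : ℝ) : ℂ) F from rfl,
        show (1 : ℂ) = ((1 : ℝ) : ℂ) by norm_num, Step8u016.segInt_eq_intJ_div,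
        Step8u016.segInt_eq_intJ_div, sub_div]
    have hnorm2 : ‖(2 : ℂ) * π * I‖ = 2 * π := by
      rw [norm_mul, norm_mul, Complex.norm_I, mul_one, Complex.norm_real, Real.norm_eq_abs,
        abs_of_pos Real.pi_pos]
      norm_num
    have hphase : ‖(((x.p : ℝ) * t0 D : ℝ) : ℂ) ^ beta3 c' D‖ = 1 :=
      Step8u012Holds.norm_cpow_beta3 x ht0pos
    rw [← mul_sub, norm_mul, hphase, one_mul, hI, norm_div, hnorm2, ← norm_neg, neg_sub]
    rw [div_le_iff₀ (by positivity)]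
    calc ‖Section7aStatements.intJ D 1 F - Section7aStatements.intJ D (alpha D) F‖
        ≤ (1 - alpha D) * (Mval + Mval) := hmove
      _ ≤ 1 * (Mval + Mval) := by gcongr; linarith
      _ ≤ Mval * (2 * π) := by nlinarith [Real.pi_gt_three]
  -- summing over `Ψ₁`
  have hsum : ‖(∑ x ∈ finsetOf (PsiOne χ),
        (((x.p : ℝ) * t0 D : ℝ) : ℂ) ^ beta3 c' D * I4 c' χ x (alpha D)) -
      ∑ x ∈ finsetOf (PsiOne χ), (((x.p : ℝ) * t0 D : ℝ) : ℂ) ^ beta3 c' D *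
        Lemma81.segInt (t0 D) (ell1 D) 1 (fun s => kfrak3 c' χ x s * omegaW D s)‖ ≤
      (finsetOf (PsiOne χ)).card * Mval := by
    rw [← Finset.sum_sub_distrib]
    calc ‖∑ x ∈ finsetOf (PsiOne χ),
          ((((x.p : ℝ) * t0 D : ℝ) : ℂ) ^ beta3 c' D * I4 c' χ x (alpha D) -
            (((x.p : ℝ) * t0 D : ℝ) : ℂ) ^ beta3 c' D *
              Lemma81.segInt (t0 D) (ell1 D) 1 (fun s => kfrak3 c' χ x s * omegaW D s))‖
        ≤ ∑ x ∈ finsetOf (PsiOne χ),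
          ‖(((x.p : ℝ) * t0 D : ℝ) : ℂ) ^ beta3 c' D * I4 c' χ x (alpha D) -
            (((x.p : ℝ) * t0 D : ℝ) : ℂ) ^ beta3 c' D *
              Lemma81.segInt (t0 D) (ell1 D) 1 (fun s => kfrak3 c' χ x s * omegaW D s)‖ :=
          norm_sum_le _ _
      _ ≤ ∑ x ∈ finsetOf (PsiOne χ), Mval := Finset.sum_le_sum hper
      _ = (finsetOf (PsiOne χ)).card * Mval := by rw [Finset.sum_const, nsmul_eq_mul]
  have hcard : ((finsetOf (PsiOne χ)).card : ℝ) ≤ 4 * bigP D ^ 2 :=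
    (Ded81Edge.card_finsetOf_psiOne_le_frakP χ).trans (hfrakP D hD₂ hℓ1)
  refine hsum.trans ((mul_le_mul_of_nonneg_right hcard hMval0).trans ?_)
  -- the final size estimate: `4P²·Mval ≤ e^{−𝓛¹⁰/16}`
  have hP : bigP D = Real.exp (ell D ^ 9) := rfl
  have hgrowth := Step8u016.growth_le hC0.le hℓ1 (by
    calc 8 * (14 + 57 * C) = Real.sqrt ((8 * (14 + 57 * C)) ^ 2) := by
          rw [Real.sqrt_sq (by positivity)]
      _ ≤ Real.sqrt (ell D) := Real.sqrt_le_sqrt hℓA)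
  -- `4K ≤ e^{𝓛¹⁰/16}`
  have hconst : 4 * K ≤ Real.exp (ell D ^ 10 / 16) := by
    have h2 : ell D ≤ ell D ^ 10 := by
      calc ell D = ell D ^ 1 := (pow_one _).symm
        _ ≤ ell D ^ 10 := pow_le_pow_right₀ hℓ1 (by norm_num)
    calc 4 * K ≤ ell D ^ 10 / 16 := by linarith
      _ ≤ ell D ^ 10 / 16 + 1 := by linarith
      _ ≤ Real.exp (ell D ^ 10 / 16) := Real.add_one_le_exp _
  -- `P¹⁴ e^{3C𝓛⁹(1+9log𝓛)} ≤ e^{𝓛¹⁰/8}`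
  have hP14 : bigP D ^ 14 = Real.exp (14 * ell D ^ 9) := by
    rw [hP, ← Real.exp_nat_mul]; norm_num
  have hmid : bigP D ^ 14 * Real.exp (3 * C * ell D ^ 9 * (1 + 9 * Real.log (ell D))) ≤
      Real.exp (ell D ^ 10 / 8) := by
    rw [hP14, ← Real.exp_add, Real.exp_le_exp]
    have : 14 * ell D ^ 9 + 3 * C * ell D ^ 9 * (1 + 9 * Real.log (ell D)) =
        (14 + 3 * C) * ell D ^ 9 + 27 * C * ell D ^ 9 * Real.log (ell D) := by ring
    rw [this]; exact hgrowth
  have hfinal : 4 * bigP D ^ 2 * Mval ≤ 1 * Real.exp (-(1 / 16) * ell D ^ 10) := by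
    have e : 4 * bigP D ^ 2 * Mval = (4 * K) *
        (bigP D ^ 14 * Real.exp (3 * C * ell D ^ 9 * (1 + 9 * Real.log (ell D)))) *
        Real.exp (-(ell D ^ 10) / 4) := by
      rw [hMval]; ring
    rw [e]
    have h1 := mul_le_mul hconst hmid (by positivity) (Real.exp_pos _).le
    have h2 := mul_le_mul_of_nonneg_right h1 (Real.exp_pos (-(ell D ^ 10) / 4)).le
    refine h2.trans (le_of_eq ?_)
    rw [← Real.exp_add, ← Real.exp_add, one_mul]
    congr 1; ring
  exact hfinal

end Assembly

end Literature.NumberTheory.LFunctions.Zhang2022.Eq172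

end
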